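import Literature.MathematicalPhysics.QuantumLattice.HubbardLiebTwoHoppings
import HarnessLib

/-!
# Lieb's Theorem 2 for a Hubbard model with two hopping constants — II. the core statement

Trunk T-QLATTICE, family `hubbard`; sequel of `HubbardLiebTwoHoppings` (see there for context).
For `X`, `Y` edge-disjoint with connected union, a common bipartition colour class `A` with
`|A| ≤ |B|`, `|Λ| = 2n`, `|A| + J = n`, hoppings `a ≠ 0`, `b ≠ 0` and `U > 0`, the ground
eigenspace of `H₂ = hamiltonian X a U + hamiltonian Y b 0` in the half-filled `2n`-particle sector
has dimension `2J + 1`, total spin `J`, and contains a nonzero `S^z = 0` vector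
(`LiebTwoHoppings.lieb_repulsive_halfFilling_core₂`). The proof is the tree's
`LiebTwo.lieb_repulsive_halfFilling_core` VERBATIM with `hamiltonian G t U ↦ H₂` and
`liebK G t n ↦ liebK X a n + liebK Y b n` (spin-space reflection positivity in the `S^z = 0`
sector, `su(2)`-multiplet structure of the ground sector, spin of the positive definite ground
matrix from the overlap with the reference state `Ξ`); the weight decomposition of the ground
sector is restated for any `(N↑, N↓)`-conserving `H` (`groundSector_weight_decomposition'`).

Source: E. H. Lieb, Phys. Rev. Lett. 62 (1989) 1201, Theorem 2 [LiebPRL1989]. No definition and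
no named fact is introduced; everything is proved.
-/

noncomputable section

namespace Literature.MathematicalPhysics.QuantumLattice

namespace LiebTwoHoppings

open Matrix Finset LiebThm1 LiebTwo
open scoped ComplexOrder

variable {Λ : Type*} [LinearOrder Λ] [Fintype Λ]
  (X Y : SimpleGraph Λ) [DecidableRel X.Adj] [DecidableRel Y.Adj]

/-! ### The ground sector of a sector-preserving Hamiltonian -/

/-- Membership in the ground eigenspace `ker(H - E) ∩ ker(N̂ - N)` of the `N`-particle sector.
[folklore] -/
theorem mem_groundSector_iff' (H : Matrix (Finset (Orb Λ)) (Finset (Orb Λ)) ℂ)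
    (N : ℕ) (E : ℝ) (ψ : Fock (Orb Λ)) :
    ψ ∈ LinearMap.ker (Matrix.toLin' (H - ((E : ℝ) : ℂ) • 1)) ⊓
        LinearMap.ker (Matrix.toLin' (totalNumber - (N : ℂ) • (1 : Matrix _ _ ℂ))) ↔
      H *ᵥ ψ = (E : ℂ) • ψ ∧ IsNParticle N ψ := by
  rw [Submodule.mem_inf, LinearMap.mem_ker, LinearMap.mem_ker, Matrix.toLin'_apply, Matrix.toLin'_apply,
    sub_mulVec, sub_mulVec, smul_mulVec, smul_mulVec, one_mulVec, sub_eq_zero, sub_eq_zero,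
    isNParticle_iff_totalNumber]

/-- Weight decomposition of the ground sector of a Hamiltonian conserving `N_↑`, `N_↓`: an
`N = 2n`-particle eigenvector is the sum of its restrictions to the `S^z = m` sectors, each again
an eigenvector. [folklore] -/
theorem groundSector_weight_decomposition' (H : Matrix (Finset (Orb Λ)) (Finset (Orb Λ)) ℂ)
    (hH : PreservesSectors H) (n : ℕ) (E : ℝ) {ψ : Fock (Orb Λ)}
    (hψ : H *ᵥ ψ = (E : ℂ) • ψ ∧ IsNParticle (2 * n) ψ) :
    ∃ (S : Finset ℤ) (w : ℤ → Fock (Orb Λ)),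
      (∀ m ∈ S, (H *ᵥ w m = (E : ℂ) • w m ∧ IsNParticle (2 * n) (w m)) ∧
        HubbardWave0.spinZ *ᵥ w m = (m : ℂ) • w m) ∧ ψ = ∑ m ∈ S, w m := by
  classical
  set wt : Finset (Orb Λ) → ℤ := fun s => ((upPart s).card : ℤ) - (downPart s).card with hwt
  set w : ℤ → Fock (Orb Λ) := fun m s => if wt s = 2 * m then ψ s else 0 with hw
  have hwt_eq : ∀ {s s' : Finset (Orb Λ)}, H s s' ≠ 0 → wt s = wt s' := by
    intro s s' h
    obtain ⟨h1, h2⟩ := hH _ _ h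
    simp only [hwt, h1, h2]
  refine ⟨Finset.Icc (-(n : ℤ)) n, w, fun m _ => ⟨⟨?_, ?_⟩, ?_⟩, ?_⟩
  · -- eigenvector
    funext s
    simp only [Pi.smul_apply, smul_eq_mul, mulVec, dotProduct]
    have hterm : ∀ s', H s s' * w m s' = if wt s = 2 * m then H s s' * ψ s' else 0 := by
      intro s'
      simp only [hw]
      by_cases hHs : H s s' = 0
      · simp [hHs]
      · rw [hwt_eq hHs]
        split_ifs <;> simp
    rw [Finset.sum_congr rfl fun s' _ => hterm s']
    simp only [hw]
    split_ifs with hs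
    · have := congrFun hψ.1 s
      simp only [mulVec, dotProduct, Pi.smul_apply, smul_eq_mul] at this
      exact this
    · rw [Finset.sum_const_zero, mul_zero]
  · -- N-particle
    intro s hs
    simp only [hw]
    split_ifs
    · exact hψ.2 s hs
    · rfl
  · -- weight
    funext s
    rw [spinZ_mulVec_apply, Pi.smul_apply, smul_eq_mul]
    simp only [hw]
    split_ifs with hs
    · have hc : (((upPart s).card : ℂ) - (downPart s).card) = ((wt s : ℤ) : ℂ) := by simp [hwt]
      rw [hc, hs]; push_cast; ring
    · simp
  · -- completeness
    funext s
    rw [Finset.sum_apply]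
    by_cases hψs : ψ s = 0
    · rw [hψs]; symm
      refine Finset.sum_eq_zero fun m _ => ?_
      simp only [hw]; split_ifs <;> simp [hψs]
    · have hcard : s.card = 2 * n := by by_contra h; exact hψs (hψ.2 s h)
      have hsum : (upPart s).card + (downPart s).card = 2 * n := by
        rw [← card_pairSet, pairSet_upPart_downPart, hcard]
      set m₀ : ℤ := ((upPart s).card : ℤ) - n with hm₀
      have hwt₀ : wt s = 2 * m₀ := by
        simp only [hwt, hm₀]
        have : ((downPart s).card : ℤ) = 2 * n - (upPart s).card := by omega
        rw [this]; ring
      rw [Finset.sum_eq_single m₀]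
      · simp only [hw]; rw [if_pos hwt₀]
      · intro m _ hm
        simp only [hw]; rw [if_neg]; rw [hwt₀]; omega
      · intro hm
        exfalso; apply hm
        rw [Finset.mem_Icc, hm₀]
        constructor <;> omega

/-! ### Lieb's Theorem 2 for `H₂` (core statement) -/

/-- **Lieb's Theorem 2 for `H₂ = H_X(a,U) + H_Y(b,0)`, core statement** (`X`, `Y` edge-disjoint
subgraphs of a bipartite graph with common colour class `A`, connected union, `|A| ≤ |B|`,
`|Λ| = 2n`, `|A| + J = n`, `a ≠ 0`, `b ≠ 0`, `U > 0`): the ground eigenspace of `H₂` in the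
half-filled sector has dimension `2J + 1` and total spin `J`. The proof is the tree's
`LiebTwo.lieb_repulsive_halfFilling_core` verbatim with Lieb's hopping matrix `K = liebK G t n`
replaced by `K₂ = liebK X a n + liebK Y b n` (Lieb's argument only uses that `K` is real symmetric
with a connected graph of nonzero entries — his "`t_{xy}` real, `Λ` connected" — which is what
`exists_posDef_groundState₂` supplies). [cite: LiebPRL1989, Theorem 2] -/
theorem lieb_repulsive_halfFilling_core₂ (hG : (X ⊔ Y).Connected)
    (hXY : ∀ x y, X.Adj x y → ¬ Y.Adj x y) (A : Finset Λ)
    (hAX : ∀ x y : Λ, X.Adj x y → (x ∈ A ↔ y ∉ A)) (hAY : ∀ x y : Λ, Y.Adj x y → (x ∈ A ↔ y ∉ A))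
    {n : ℕ} (hΛ : Fintype.card Λ = 2 * n) {J : ℕ} (hAJ : A.card + J = n)
    {a b U : ℝ} (ha : a ≠ 0) (hb : b ≠ 0) (hU : 0 < U) :
    Module.finrank ℂ ↥(LinearMap.ker (Matrix.toLin' ((hamiltonian X a U + hamiltonian Y b 0) -
        ((groundEnergy (hamiltonian X a U + hamiltonian Y b 0) (2 * n) : ℝ) : ℂ) • 1)) ⊓
        LinearMap.ker (Matrix.toLin' (totalNumber - ((2 * n : ℕ) : ℂ) • (1 : Matrix _ _ ℂ)))) = 2 * J + 1 ∧
      (∀ ψ ∈ LinearMap.ker (Matrix.toLin' ((hamiltonian X a U + hamiltonian Y b 0) -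
          ((groundEnergy (hamiltonian X a U + hamiltonian Y b 0) (2 * n) : ℝ) : ℂ) • 1)) ⊓
          LinearMap.ker (Matrix.toLin' (totalNumber - ((2 * n : ℕ) : ℂ) • (1 : Matrix _ _ ℂ))),
        spinSq *ᵥ ψ = ((J : ℂ) * (J + 1)) • ψ) ∧
      ∃ ψ₀ ∈ LinearMap.ker (Matrix.toLin' ((hamiltonian X a U + hamiltonian Y b 0) -
          ((groundEnergy (hamiltonian X a U + hamiltonian Y b 0) (2 * n) : ℝ) : ℂ) • 1)) ⊓
          LinearMap.ker (Matrix.toLin' (totalNumber - ((2 * n : ℕ) : ℂ) • (1 : Matrix _ _ ℂ))),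
        ψ₀ ≠ 0 ∧ HubbardWave0.spinZ *ᵥ ψ₀ = 0 := by
  classical
  set H := hamiltonian X a U + hamiltonian Y b 0 with hHdef
  set K₂ := liebK X a n + liebK Y b n with hK₂
  set N := 2 * n with hNdef
  set E₀ := groundEnergy H N with hE₀
  set V := LinearMap.ker (Matrix.toLin' (H - ((E₀ : ℝ) : ℂ) • 1)) ⊓
    LinearMap.ker (Matrix.toLin' (totalNumber - (N : ℂ) • (1 : Matrix (Finset (Orb Λ)) _ ℂ))) with hVdef
  have hHerm : H.IsHermitian := hamiltonian₂_isHermitian X Y a b U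
  have hPres : PreservesSectors H := preservesSectors_hamiltonian₂ X Y a b U
  have hmemV : ∀ ψ, ψ ∈ V ↔ H *ᵥ ψ = (E₀ : ℂ) • ψ ∧ IsNParticle N ψ := fun ψ =>
    mem_groundSector_iff' H N E₀ ψ
  -- spectral theory in the `N`-particle sector
  have hK : ∀ v, v ∈ Literature.MathematicalPhysics.QuantumLattice.nParticleSubmodule (ι := Orb Λ) N ↔ ∀ s, ¬ (s.card = N) → v s = 0 :=
    fun v => Iff.rfl
  have hE₀' : E₀ = H.minEnergyOn (Literature.MathematicalPhysics.QuantumLattice.nParticleSubmodule N) :=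
    groundEnergy_eq_minEnergyOn H N _ fun ψ => Iff.rfl
  have hp : ∃ s : Finset (Orb Λ), s.card = N := ⟨pairSet univ ∅, by rw [card_pairSet, card_univ, hΛ]; simp [hNdef]⟩
  have hinv : ∀ s s' : Finset (Orb Λ), ¬ s.card = N → s'.card = N → H s s' = 0 := by
    intro s s' hs hs'
    by_contra hne
    obtain ⟨h1, h2⟩ := hPres _ _ hne
    apply hs
    rw [← pairSet_upPart_downPart s, card_pairSet, h1, h2, ← card_pairSet, pairSet_upPart_downPart]
    exact hs'
  obtain ⟨⟨v₁, hv₁K, hv₁0, hv₁eq⟩, hvar⟩ := Literature.MathematicalPhysics.QuantumLattice.sector_groundState H hHerm (fun s => s.card = N)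
    hp hinv (Literature.MathematicalPhysics.QuantumLattice.nParticleSubmodule N) hK
  rw [← hE₀'] at hv₁eq hvar
  have hv₁V : v₁ ∈ V := (hmemV v₁).2 ⟨hv₁eq, hv₁K⟩
  have hVne : V ≠ ⊥ := fun h => hv₁0 (by rw [h] at hv₁V; exact (Submodule.mem_bot ℂ).1 hv₁V)
  -- invariance of `V` under the spin operators
  have hPV : ∀ ψ ∈ V, spinPlus *ᵥ ψ ∈ V := by
    intro ψ hψ
    rw [hmemV] at hψ ⊢
    refine ⟨?_, isNParticle_mulVec_of_commute hψ.2 totalNumber_mul_spinPlus⟩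
    rw [mulVec_mulVec, hHdef, (hamiltonian₂_commute_spinPlus X Y a b U).eq, ← mulVec_mulVec, ← hHdef, hψ.1,
      mulVec_smul]
  have hMV : ∀ ψ ∈ V, Literature.MathematicalPhysics.QuantumLattice.spinMinus *ᵥ ψ ∈ V := by
    intro ψ hψ
    rw [hmemV] at hψ ⊢
    refine ⟨?_, isNParticle_mulVec_of_commute hψ.2 totalNumber_mul_spinMinus⟩
    rw [mulVec_mulVec, hHdef, (hamiltonian₂_commute_spinMinus X Y a b U).eq, ← mulVec_mulVec, ← hHdef, hψ.1,
      mulVec_smul]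
  have hZV : ∀ ψ ∈ V, HubbardWave0.spinZ *ᵥ ψ ∈ V := by
    intro ψ hψ
    rw [hmemV] at hψ ⊢
    refine ⟨?_, isNParticle_mulVec_of_commute hψ.2 totalNumber_mul_spinZ⟩
    rw [mulVec_mulVec, hHdef, (hamiltonian₂_commute_spinZ X Y a b U).eq, ← mulVec_mulVec, ← hHdef,
      hψ.1, mulVec_smul]
  have hwt : ∀ v ∈ V, ∃ (S : Finset ℤ) (w : ℤ → Fock (Orb Λ)),
      (∀ m ∈ S, w m ∈ V ∧ HubbardWave0.spinZ *ᵥ w m = (m : ℂ) • w m) ∧ v = ∑ m ∈ S, w m := by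
    intro v hv
    obtain ⟨S, w, hw, hsum⟩ := groundSector_weight_decomposition' H hPres n E₀ ((hmemV v).1 hv)
    exact ⟨S, w, fun m hm => ⟨(hmemV _).2 (hw m hm).1, (hw m hm).2⟩, hsum⟩
  obtain ⟨hC1, hC2⟩ := Literature.MathematicalPhysics.QuantumLattice.IsSu2Triple.su2_multiplet isSu2Triple_spin V hPV hMV hwt
  -- Lieb's lemma in the `S^z = 0` sector
  have hn : n ≤ (univ : Finset Λ).card := by rw [card_univ, hΛ]; omega
  obtain ⟨α₀, -, hα₀⟩ := Finset.exists_subset_card_eq hn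
  haveI : Nonempty (Config Λ n) := ⟨⟨α₀, hα₀⟩⟩
  obtain ⟨W₀, hW₀pd, hW₀gs, huniq⟩ := exists_posDef_groundState₂ X Y hG hXY ha hb hU n
  have hT : K₂.IsHermitian ∧ K₂.IsSymm := liebK₂_isHermitian_isSymm X Y a b n
  set LM := Literature.MathematicalPhysics.QuantumLattice.SpinReflection.liebMatrix K₂ (occInd n) (-U) with hLM
  set e := LM.groundEnergy with he
  set ψ₀ := toFockN A n W₀ with hψ₀def
  -- properties of `Φ`
  have hΦN : ∀ W, IsNParticle N (toFockN A n W) := by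
    intro W s hs
    by_contra h
    obtain ⟨h1, h2⟩ := toFockN_apply_ne_zero A n W h
    apply hs
    rw [Finset.card_compl, hΛ, hNdef] at h2
    have hle : (downPart s).card ≤ 2 * n := by rw [← hNdef, ← hΛ]; exact Finset.card_le_univ _
    rw [← pairSet_upPart_downPart s, card_pairSet, h1, hNdef]
    omega
  have hΦH : ∀ W, H *ᵥ toFockN A n W =
      toFockN A n (Literature.MathematicalPhysics.QuantumLattice.liebOp K₂ (fun x => Literature.MathematicalPhysics.QuantumLattice.SpinReflection.rdiag (occInd n x)) (-U) W) +
        ((U : ℂ) * n) • toFockN A n W := hamiltonian₂_mulVec_toFockN X Y A hAX hAY a b U n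
  have hΦZ0 : ∀ W, HubbardWave0.spinZ *ᵥ toFockN A n W = 0 := by
    intro W; funext s
    rw [spinZ_mulVec_apply, Pi.zero_apply]
    by_cases h : toFockN A n W s = 0
    · rw [h, mul_zero]
    · obtain ⟨h1, h2⟩ := toFockN_apply_ne_zero A n W h
      rw [Finset.card_compl, hΛ, hNdef] at h2
      have hle : (downPart s).card ≤ 2 * n := by rw [← hNdef, ← hΛ]; exact Finset.card_le_univ _
      have h3 : (downPart s).card = n := by omega
      rw [h1, h3, sub_self, mul_zero, zero_mul]
  have hsec : ∀ ψ ∈ V, HubbardWave0.spinZ *ᵥ ψ = 0 → toFockN A n (resMatrix n (ofFock A ψ)) = ψ := by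
    intro ψ hψ hZ
    apply toFockN_resMatrix_ofFock
    intro s hs
    have hcard : s.card = N := by by_contra h; exact hs (((hmemV ψ).1 hψ).2 s h)
    have hz := congrFun hZ s
    rw [spinZ_mulVec_apply, Pi.zero_apply, mul_eq_zero, mul_eq_zero] at hz
    rcases hz with (hz | hz) | hz
    · norm_num at hz
    · rw [sub_eq_zero] at hz
      have hz' : (upPart s).card = (downPart s).card := by exact_mod_cast hz
      rw [← pairSet_upPart_downPart s, card_pairSet, hNdef] at hcard
      rw [Finset.card_compl, hΛ, hNdef]
      omega
    · exact absurd hz hs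
  have heig : ∀ W, toFockN A n W ∈ V → LM *ᵥ vec W = ((E₀ - U * n : ℝ) : ℂ) • vec W := by
    intro W hW
    rw [hmemV] at hW
    have h1 := hW.1
    rw [hΦH] at h1
    have h2 : toFockN A n (Literature.MathematicalPhysics.QuantumLattice.liebOp K₂ (fun x => Literature.MathematicalPhysics.QuantumLattice.SpinReflection.rdiag (occInd n x)) (-U) W) =
        toFockN A n (((E₀ - U * n : ℝ) : ℂ) • W) := by
      rw [toFockN_smul]
      have hc : ((E₀ - U * n : ℝ) : ℂ) = (E₀ : ℂ) - (U : ℂ) * n := by push_cast; ring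
      rw [hc, sub_smul]
      exact eq_sub_of_add_eq h1
    have h3 := toFockN_injective A n h2
    rw [hLM, Literature.MathematicalPhysics.QuantumLattice.SpinReflection.liebMatrix_mulVec_vec hT.2, h3, vec_smul]
  -- the ground energies coincide: `E₀ = e + U n`
  have hW₀ne : W₀ ≠ 0 := by
    intro h
    have := hW₀pd.diag_pos (i := ⟨α₀, hα₀⟩)
    rw [h] at this
    exact lt_irrefl _ this
  have hψ₀ne : ψ₀ ≠ 0 := fun h => hW₀ne (toFockN_injective A n (by rw [← hψ₀def, h, toFockN_zero]))
  have hliebOpW₀ : Literature.MathematicalPhysics.QuantumLattice.liebOp K₂ (fun x => Literature.MathematicalPhysics.QuantumLattice.SpinReflection.rdiag (occInd n x)) (-U) W₀ =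
      (e : ℂ) • W₀ := (Literature.MathematicalPhysics.QuantumLattice.SpinReflection.mem_groundSpace_iff_liebOp hT.2 (occInd n) (-U) W₀).1 hW₀gs
  have hHψ₀ : H *ᵥ ψ₀ = ((e + U * n : ℝ) : ℂ) • ψ₀ := by
    rw [hψ₀def, hΦH, hliebOpW₀, toFockN_smul, ← add_smul]
    push_cast; rfl
  have hle : E₀ ≤ e + U * n := by
    obtain ⟨c, -, hc1⟩ := Literature.MathematicalPhysics.QuantumLattice.exists_smul_unit hψ₀ne
    have hmem : c • ψ₀ ∈ Literature.MathematicalPhysics.QuantumLattice.nParticleSubmodule (ι := Orb Λ) N := Submodule.smul_mem _ c (hΦN W₀)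
    have h := hvar (c • ψ₀) hmem hc1
    rw [mulVec_smul, hHψ₀, smul_comm, dotProduct_smul, hc1, smul_eq_mul, mul_one, Complex.ofReal_re] at h
    exact h
  have hge : e + U * n ≤ E₀ := by
    obtain ⟨φ, hφV, hφ0, hφZ⟩ := hC1 hVne
    set W := resMatrix n (ofFock A φ) with hWdef
    have hφW : toFockN A n W = φ := hsec φ hφV hφZ
    have hWV : toFockN A n W ∈ V := by rw [hφW]; exact hφV
    have hLMW := heig W hWV
    have hW0 : vec W ≠ 0 := by
      intro h
      rw [← vec_zero, vec_inj] at h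
      exact hφ0 (by rw [← hφW, h, toFockN_zero])
    obtain ⟨c, -, hc1⟩ := Literature.MathematicalPhysics.QuantumLattice.exists_smul_unit hW0
    have h := Matrix.groundEnergy_le_rayleigh_holds
      (Literature.MathematicalPhysics.QuantumLattice.SpinReflection.liebMatrix_isHermitian hT.1 (occInd n) (-U)) (c • vec W) hc1
    rw [mulVec_smul, ← hLM, hLMW, smul_comm, dotProduct_smul, hc1, smul_eq_mul, mul_one, Complex.ofReal_re] at h
    change e ≤ E₀ - U * n at h
    linarith
  have hE : E₀ = e + U * n := le_antisymm hle hge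
  -- the weight-zero line of `V`
  have hψ₀V : ψ₀ ∈ V := (hmemV ψ₀).2 ⟨by rw [hHψ₀, hE], hΦN W₀⟩
  have hψ₀Z : HubbardWave0.spinZ *ᵥ ψ₀ = 0 := hΦZ0 W₀
  have hW0line : ∀ ψ ∈ V, HubbardWave0.spinZ *ᵥ ψ = 0 → ∃ c : ℂ, ψ = c • ψ₀ := by
    intro ψ hψ hZ
    set W := resMatrix n (ofFock A ψ) with hWdef
    have hψW : toFockN A n W = ψ := hsec ψ hψ hZ
    have hWV : toFockN A n W ∈ V := by rw [hψW]; exact hψ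
    have hLMW := heig W hWV
    rw [hE, show ((e + U * n - U * n : ℝ) : ℂ) = (e : ℂ) by push_cast; ring] at hLMW
    have hgs : vec W ∈ LM.groundSpace := (Matrix.mem_groundSpace_iff _ _).2 hLMW
    obtain ⟨c, hc⟩ := huniq _ hgs
    refine ⟨c, ?_⟩
    have hWc : W = c • W₀ := vec_inj.1 (by rw [hc, vec_smul])
    rw [← hψW, hWc, toFockN_smul]
  -- the spin of `ψ₀` from the overlap with the reference state
  have hS2ψ₀ : spinSq *ᵥ ψ₀ = ((J : ℂ) * (J + 1)) • ψ₀ := by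
    have hmem : spinSq *ᵥ ψ₀ ∈ V := by
      rw [spinSq, add_mulVec, smul_mulVec, add_mulVec, ← mulVec_mulVec, ← mulVec_mulVec, ← mulVec_mulVec]
      exact V.add_mem (hZV _ (hZV _ hψ₀V)) (V.smul_mem _ (V.add_mem (hPV _ (hMV _ hψ₀V)) (hMV _ (hPV _ hψ₀V))))
    have hZ : HubbardWave0.spinZ *ᵥ (spinSq *ᵥ ψ₀) = 0 := by
      rw [mulVec_mulVec, ← su2Casimir_spin_eq_spinSq, ← isSu2Triple_spin.su2Casimir_mul_Z, ← mulVec_mulVec, hψ₀Z,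
        mulVec_zero]
    obtain ⟨c, hc⟩ := hW0line _ hmem hZ
    have hov : star (refState A n J) ⬝ᵥ ψ₀ ≠ 0 := refState_overlap_ne_zero A n J hW₀pd
    have h1 : star (refState A n J) ⬝ᵥ (spinSq *ᵥ ψ₀) = ((J : ℂ) * (J + 1)) * (star (refState A n J) ⬝ᵥ ψ₀) := by
      rw [dotProduct_mulVec, show star (refState A n J) ᵥ* spinSq = star (spinSq *ᵥ refState A n J) by
        rw [star_mulVec, spinSq_conjTranspose], spinSq_mulVec_refState A hΛ hAJ, star_smul, smul_dotProduct,
        smul_eq_mul]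
      congr 1
      simp
    rw [hc, dotProduct_smul, smul_eq_mul] at h1
    have hcJ : c = (J : ℂ) * (J + 1) := mul_right_cancel₀ hov h1
    rw [hc, hcJ]
  obtain ⟨hrank, hCV⟩ := hC2 ψ₀ J hψ₀V hψ₀ne hψ₀Z hW0line (by rw [su2Casimir_spin_eq_spinSq]; exact hS2ψ₀)
  exact ⟨hrank, fun ψ hψ => by rw [← su2Casimir_spin_eq_spinSq]; exact hCV ψ hψ, ψ₀, hψ₀V, hψ₀ne, hψ₀Z⟩

end LiebTwoHoppings

end Literature.MathematicalPhysics.QuantumLattice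

end
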